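import Summits.RiemannHypothesis.RiemannHypothesis.Theorems.HandoffDodgerAsymptoticsB
import Summits.RiemannHypothesis.RiemannHypothesis.Theorems.HandoffDodgerAsymptoticsD
import HarnessLib

/-!
# HANDOFF — SMALL THRESHOLD (1): the horizon inequalities of `dodger_witness_explicit` for every `b ≥ 11/2` (rh-explicit, D-0040 WEIL column prover seat handoff-prove-2 gen11, ATTEMPT-21 §2)

HONEST FRAMING. Nothing here bears on the truth of RH; elementary real analysis (Mathlib + the definitions `dodgerT₀`,
`dodgerTstar`, `dodgerKprime`, `dodgerTprime`, `dodgerCI`, `dodgerW`, `dodgerPL`, `dodgerPU` of the gen10 files, which are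
`b`-generic). gen10's parts (A)/(B) (`horizon_sizes`, `horizon_side_conditions`, `horizon_index_bounds`, `horizon_sizes_B`) prove the
«horizon group» of hypotheses of `HandoffDodgerExplicit.dodger_witness_explicit` for `b ≥ 60` by polynomial minorants of `e^{2b}`;
here the same conclusions (with `s₁(T₀) ≤ 3b` in place of `s₁(T₀) ≤ b`, which is false below `b ≈ 12`) are proved for every
`b ≥ 11/2`, i.e. for every prime `q ≥ 60000` at the track's choice `b = (log q)/2 − ε`, from the numerical floor `e^{11} ≥ 59000`
(`exp_eleven_ge`) and `e^{2b} ≥ 59000(1 + (2b−11) + (2b−11)²/2)`. Extra conclusions used by the later parts: `17e^{2b} ≤ T′`,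
`1300(b+1)² ≤ e^{2b}`. No `sorry`, standard axioms.

References: this track (ATTEMPT-16 §6.1 (Q1)–(Q2), (Q9); ATTEMPT-19 §8; ATTEMPT-21 §2).
-/

set_option linter.dupNamespace false

noncomputable section

open Real

namespace Summit.RiemannHypothesis.RiemannHypothesis.Theorems.Handoff

/-! ## Numerical floor -/

/-- `59000 ≤ e^{11} ≤ 59875`. [folklore] -/
theorem exp_eleven_bounds : (59000 : ℝ) ≤ Real.exp 11 ∧ Real.exp 11 ≤ 59875 := by
  have h11 : Real.exp 11 = Real.exp 1 ^ 11 := by exact_mod_cast (Real.exp_one_pow 11).symm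
  have hgt := Real.exp_one_gt_d9
  have hlt := Real.exp_one_lt_d9
  have h0 := Real.exp_pos 1
  constructor
  · rw [h11]
    have h := pow_le_pow_left₀ (by norm_num) hgt.le 11
    exact le_trans (by norm_num) h
  · rw [h11]
    have h := pow_le_pow_left₀ h0.le hlt.le 11
    exact le_trans h (by norm_num)

/-- For `b ≥ 11/2`: `e^{2b} ≥ 59000`, `e^{2b} ≥ 1300(b+1)²`, `e^{2b} ≥ 9000(b+1)` (from `e^{2b} = e^{11}e^{2b−11}` and
`1 + t + t²/2 ≤ e^t`). [this track, ATTEMPT-21 §2] -/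
theorem exp_two_mul_bounds {b : ℝ} (hb : 11 / 2 ≤ b) :
    59000 ≤ Real.exp (2 * b) ∧ 1300 * (b + 1) ^ 2 ≤ Real.exp (2 * b) ∧ 9000 * (b + 1) ≤ Real.exp (2 * b) := by
  obtain ⟨h11, -⟩ := exp_eleven_bounds
  set t : ℝ := 2 * b - 11 with ht
  have ht0 : 0 ≤ t := by rw [ht]; linarith
  have hsplit : Real.exp (2 * b) = Real.exp 11 * Real.exp t := by rw [← Real.exp_add]; congr 1; rw [ht]; ring
  have hq : 1 + t + t ^ 2 / 2 ≤ Real.exp t := Real.quadratic_le_exp_of_nonneg ht0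
  have hmain : 59000 * (1 + t + t ^ 2 / 2) ≤ Real.exp (2 * b) := by
    rw [hsplit]; exact mul_le_mul h11 hq (by positivity) (Real.exp_pos 11).le
  have hpoly2 : 1300 * (b + 1) ^ 2 ≤ 59000 * (1 + t + t ^ 2 / 2) := by
    rw [ht]; nlinarith only [hb]
  have hpoly3 : 9000 * (b + 1) ≤ 59000 * (1 + t + t ^ 2 / 2) := by
    rw [ht]; nlinarith only [hb]
  refine ⟨by nlinarith only [hmain, ht0], hpoly2.trans hmain, hpoly3.trans hmain⟩

/-! ## Basic sizes -/

/-- For `b ≥ 11/2`: `e ≤ T₀`, `17e^{2b} ≤ T₀ ≤ 17.08e^{2b}`, `10 ≤ s₁(T₀) ≤ 3b`. [this track, ATTEMPT-21 §2] -/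
theorem small_horizon_sizes {b : ℝ} (hb : 11 / 2 ≤ b) :
    Real.exp 1 ≤ dodgerT₀ b ∧ 17 * Real.exp (2 * b) ≤ dodgerT₀ b ∧ dodgerT₀ b ≤ 17.08 * Real.exp (2 * b) ∧
      10 ≤ (0.1038 * Real.log (dodgerT₀ b) + 0.2573 * Real.log (Real.log (dodgerT₀ b)) + 9.3675) ∧ (0.1038 * Real.log (dodgerT₀ b) + 0.2573 * Real.log (Real.log (dodgerT₀ b)) + 9.3675) ≤ 3 * b := by
  have hπ3 : 3.1415 < π := Real.pi_gt_d4
  have hπ4 : π < 3.1416 := Real.pi_lt_d4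
  have hegt := Real.exp_one_gt_d9
  have helt := Real.exp_one_lt_d9
  obtain ⟨he59, -, -⟩ := exp_two_mul_bounds hb
  set T₀ := dodgerT₀ b with hT₀
  have hTe : T₀ = 2 * π * Real.exp 1 * Real.exp (2 * b) := by
    rw [hT₀, dodgerT₀, Real.exp_add]; ring
  have hc1 : (17 : ℝ) ≤ 2 * π * Real.exp 1 := by nlinarith only [hπ3, hegt]
  have hc2 : 2 * π * Real.exp 1 ≤ 17.08 := by nlinarith only [hπ4, helt, hπ3, hegt]
  have hlo : 17 * Real.exp (2 * b) ≤ T₀ := by rw [hTe]; exact mul_le_mul_of_nonneg_right hc1 (Real.exp_pos _).le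
  have hhi : T₀ ≤ 17.08 * Real.exp (2 * b) := by rw [hTe]; exact mul_le_mul_of_nonneg_right hc2 (Real.exp_pos _).le
  have hT₀e : Real.exp 1 ≤ T₀ := by nlinarith only [hlo, he59, helt]
  have hT₀pos : 0 < T₀ := lt_of_lt_of_le (Real.exp_pos 1) hT₀e
  have hlog : Real.log T₀ = Real.log (2 * π) + 1 + 2 * b := by
    rw [hT₀, dodgerT₀, Real.log_mul (by positivity) (Real.exp_pos _).ne', Real.log_exp]; ring
  have hl2π0 : 0 ≤ Real.log (2 * π) := Real.log_nonneg (by linarith)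
  have hl2π2 : Real.log (2 * π) ≤ 2 := by
    have h72 := exp_numerics.2.1
    have : 2 * π ≤ Real.exp 2 := by linarith
    calc Real.log (2 * π) ≤ Real.log (Real.exp 2) := Real.log_le_log (by positivity) this
      _ = 2 := Real.log_exp 2
  have hlogT₀1 : 1 ≤ Real.log T₀ := by rw [hlog]; linarith
  have hlogT₀ge : 2 * b + 1 ≤ Real.log T₀ := by rw [hlog]; linarith
  have hlogT₀le : Real.log T₀ ≤ 2 * b + 3 := by rw [hlog]; linarith
  have hll0 : 0 ≤ Real.log (Real.log T₀) := Real.log_nonneg hlogT₀1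
  have hll : Real.log (Real.log T₀) ≤ Real.log T₀ - 1 := Real.log_le_sub_one_of_pos (by linarith)
  refine ⟨hT₀e, hlo, hhi, by nlinarith only [hlogT₀ge, hll0, hb], by nlinarith only [hlogT₀le, hll, hb]⟩

/-- For `b ≥ 11/2`: the two clean-horizon side conditions `T₀ ≤ (11/10)T*` and `s + 1 ≤ (14/2π)log(T₀/14)`.
[this track, ATTEMPT-16 (Q1a)(Q1b); ATTEMPT-21 §2] -/
theorem small_horizon_side_conditions {b : ℝ} (hb : 11 / 2 ≤ b) :
    dodgerT₀ b ≤ 11 / 10 * (dodgerT₀ b - 4 * π * ((0.1038 * Real.log (dodgerT₀ b) + 0.2573 * Real.log (Real.log (dodgerT₀ b)) + 9.3675) + 2)) ∧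
    (0.1038 * Real.log (dodgerT₀ b) + 0.2573 * Real.log (Real.log (dodgerT₀ b)) + 9.3675) + 1 ≤ 14 / (2 * π) * Real.log (dodgerT₀ b / 14) := by
  obtain ⟨hT₀e, hT₀ge, -, hs9, hsb⟩ := small_horizon_sizes hb
  obtain ⟨-, -, he9⟩ := exp_two_mul_bounds hb
  have hπ3 : 3 < π := Real.pi_gt_three
  have hπ4 : π < 3.15 := Real.pi_lt_d2
  set T₀ := dodgerT₀ b with hT₀
  set s := (0.1038 * Real.log (dodgerT₀ b) + 0.2573 * Real.log (Real.log (dodgerT₀ b)) + 9.3675) with hs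
  have hT₀pos : 0 < T₀ := lt_of_lt_of_le (Real.exp_pos 1) hT₀e
  constructor
  · -- `44π(s+2) ≤ T₀`
    have h1 : 4 * π * (s + 2) ≤ 12.6 * (3 * b + 2) := by
      have := mul_nonneg (by linarith only [hπ4] : (0:ℝ) ≤ 3.15 - π) (by linarith only [hs9] : (0:ℝ) ≤ s + 2)
      nlinarith only [this, hsb, hπ3, hs9]
    nlinarith only [h1, hT₀ge, he9, hb]
  · have hlog : Real.log (T₀ / 14) = Real.log (2 * π) + 1 + 2 * b - Real.log 14 := by
      rw [Real.log_div hT₀pos.ne' (by norm_num), hT₀, dodgerT₀, Real.log_mul (by positivity) (Real.exp_pos _).ne', Real.log_exp]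
      ring
    have hl2π0 : 0 ≤ Real.log (2 * π) := Real.log_nonneg (by linarith)
    have hl14 : Real.log 14 ≤ 3 := by
      rw [show (14 : ℝ) = 2 * 7 by norm_num, Real.log_mul (by norm_num) (by norm_num)]
      have h2 : Real.log 2 < 0.6931471808 := Real.log_two_lt_d9
      have h7 : Real.log 7 ≤ 2 := by
        have := Real.log_le_sub_one_of_pos (show (0:ℝ) < 7 / Real.exp 2 by positivity)
        rw [Real.log_div (by norm_num) (Real.exp_pos 2).ne', Real.log_exp] at this
        have he : 7 / Real.exp 2 ≤ 1 := by
          rw [div_le_one (Real.exp_pos 2)]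
          linarith [exp_numerics.2.1]
        linarith
      linarith
    rw [hlog]
    have h14 : (2.2 : ℝ) ≤ 14 / (2 * π) := by rw [le_div_iff₀ (by positivity)]; linarith
    have hpos : 0 ≤ Real.log (2 * π) + 1 + 2 * b - Real.log 14 := by linarith
    calc s + 1 ≤ 2.2 * (Real.log (2 * π) + 1 + 2 * b - Real.log 14) := by nlinarith only [hsb, hl2π0, hl14, hb]
      _ ≤ 14 / (2 * π) * (Real.log (2 * π) + 1 + 2 * b - Real.log 14) := mul_le_mul_of_nonneg_right h14 hpos

/-- For `b ≥ 11/2`: the lattice index `k′` satisfies `T* − π/b ≤ πk′/b ≤ T*`, `3 ≤ πk′/b`, `2 ≤ k′`,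
`2 ≤ πk′/b − π(3s+5)/b`, `1 ≤ k′ − 3s − 5`, and `πk′/b ≤ T₀`. [this track, ATTEMPT-16 §1; ATTEMPT-21 §2] -/
theorem small_horizon_index_bounds {b : ℝ} (hb : 11 / 2 ≤ b) :
    π * (dodgerKprime b) / b ≤ dodgerTstar b ∧
    dodgerTstar b - π / b ≤ π * (dodgerKprime b) / b ∧
    3 ≤ π * (dodgerKprime b) / b ∧ 2 ≤ dodgerKprime b ∧
    2 ≤ π * (dodgerKprime b) / b - π * (3 * (0.1038 * Real.log (dodgerT₀ b) + 0.2573 * Real.log (Real.log (dodgerT₀ b)) + 9.3675) + 5) / b ∧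
    1 ≤ (dodgerKprime b : ℝ) - 3 * (0.1038 * Real.log (dodgerT₀ b) + 0.2573 * Real.log (Real.log (dodgerT₀ b)) + 9.3675) - 5 ∧
    π * (dodgerKprime b) / b ≤ dodgerT₀ b := by
  obtain ⟨hT₀e, hT₀ge, -, hs9, hsb⟩ := small_horizon_sizes hb
  obtain ⟨he59, -, he9⟩ := exp_two_mul_bounds hb
  have hπ3 : 3 < π := Real.pi_gt_three
  have hπ4 : π < 3.15 := Real.pi_lt_d2
  have hπ := Real.pi_pos
  have hb0 : 0 < b := by linarith
  set T₀ := dodgerT₀ b with hT₀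
  set s := (0.1038 * Real.log (dodgerT₀ b) + 0.2573 * Real.log (Real.log (dodgerT₀ b)) + 9.3675) with hs
  have hTs : dodgerTstar b = T₀ - 4 * π * (s + 2) := rfl
  set Ts := dodgerTstar b with hTsdef
  have h4πs : 4 * π * (s + 2) ≤ 12.6 * (3 * b + 2) := by
    have := mul_nonneg (by linarith only [hπ4] : (0:ℝ) ≤ 3.15 - π) (by linarith only [hs9] : (0:ℝ) ≤ s + 2)
    nlinarith only [this, hsb, hπ3, hs9]
  have hTs0 : 16.9 * Real.exp (2 * b) ≤ Ts := by rw [hTs]; nlinarith only [h4πs, hT₀ge, he9, hb]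
  have hTsbig : 900000 ≤ Ts := by nlinarith only [hTs0, he59]
  have hTspos : 0 < Ts := by linarith
  -- the floor
  have hx0 : 0 ≤ b * Ts / π := by positivity
  have hk1 : ((dodgerKprime b : ℕ) : ℝ) ≤ b * Ts / π := Nat.floor_le hx0
  have hk2 : b * Ts / π - 1 ≤ ((dodgerKprime b : ℕ) : ℝ) := by
    have := Nat.lt_floor_add_one (b * Ts / π); rw [dodgerKprime]; linarith
  have hA : π * (dodgerKprime b) / b ≤ Ts := by
    rw [div_le_iff₀ hb0]
    have := mul_le_mul_of_nonneg_left hk1 hπ.le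
    rw [mul_div_assoc', mul_comm π (b * Ts), mul_div_assoc, div_self hπ.ne', mul_one] at this
    linarith
  have hB : Ts - π / b ≤ π * (dodgerKprime b) / b := by
    rw [le_div_iff₀ hb0, sub_mul, div_mul_cancel₀ _ hb0.ne']
    have := mul_le_mul_of_nonneg_left hk2 hπ.le
    rw [mul_sub, mul_one, mul_div_assoc', mul_comm π (b * Ts), mul_div_assoc, div_self hπ.ne', mul_one] at this
    linarith
  have hπb : π / b ≤ 1 := by rw [div_le_one hb0]; linarith
  have hπsb : π * (3 * s + 5) / b ≤ 32 := by
    rw [div_le_iff₀ hb0]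
    have : π * (3 * s + 5) ≤ 3.15 * (9 * b + 5) := by
      have := mul_nonneg (by linarith only [hπ4] : (0:ℝ) ≤ 3.15 - π) (by linarith only [hs9] : (0:ℝ) ≤ 3 * s + 5)
      nlinarith only [this, hsb, hπ3, hs9]
    nlinarith only [this, hb]
  have hkr : Ts - 1 ≤ ((dodgerKprime b : ℕ) : ℝ) := by
    have : b * Ts / π ≥ Ts := by
      rw [ge_iff_le, le_div_iff₀ hπ]; nlinarith only [hb, hπ4, hTspos]
    linarith
  refine ⟨hA, hB, by linarith, ?_, by linarith, by nlinarith only [hkr, hsb, hTs0, he9, hb], ?_⟩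
  · have : (2 : ℝ) ≤ ((dodgerKprime b : ℕ) : ℝ) := by linarith
    exact_mod_cast this
  · have : Ts ≤ T₀ := by rw [hTs]; nlinarith only [hπ3, hs9]
    linarith

/-- **Part (1) of the small-threshold discharge.** For `b ≥ 11/2`: all «part (B)» sizes of gen10's `horizon_sizes_B` — `T₀ ≤ 1.01T′`,
`T′ ≤ T₀`, `e^{2b} ≤ T′`, `3600 ≤ T′`, `T′³/(19π) ≤ cI ≤ T′³`, `1024 ≤ 4cI`, `T′³/(10π) ≤ pL`, `0 < pU ≤ (41/100)bT′³`,
`T′² ≤ W ≤ 1.01T′²`, `2 ≤ k′ ≤ (2/5)bT′` — and in addition `17e^{2b} ≤ T′`. [this track, ATTEMPT-21 §2] -/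
theorem small_horizon_sizes_B {b : ℝ} (hb : 11 / 2 ≤ b) :
    dodgerT₀ b ≤ 101 / 100 * dodgerTprime b ∧ dodgerTprime b ≤ dodgerT₀ b ∧ Real.exp (2 * b) ≤ dodgerTprime b ∧
    3600 ≤ dodgerTprime b ∧
    dodgerTprime b ^ 3 / (19 * π) ≤ dodgerCI b ∧ dodgerCI b ≤ dodgerTprime b ^ 3 ∧ 1024 ≤ 4 * dodgerCI b ∧
    dodgerTprime b ^ 3 / (10 * π) ≤ dodgerPL b ∧
    0 < dodgerPU b ∧ dodgerPU b ≤ 41 / 100 * b * dodgerTprime b ^ 3 ∧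
    dodgerTprime b ^ 2 ≤ dodgerW b ∧ dodgerW b ≤ 101 / 100 * dodgerTprime b ^ 2 ∧
    (2 : ℝ) ≤ (dodgerKprime b : ℝ) ∧ (dodgerKprime b : ℝ) ≤ 2 / 5 * b * dodgerTprime b ∧
    17 * Real.exp (2 * b) ≤ dodgerTprime b := by
  obtain ⟨hT₀e, hT₀ge, hT₀le, hs9, hsb⟩ := small_horizon_sizes hb
  obtain ⟨he59, he2, he9⟩ := exp_two_mul_bounds hb
  obtain ⟨hA, hB, hT3, hk2, hℓ2, hK1, hAT₀⟩ := small_horizon_index_bounds hb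
  have hπ3 : 3 < π := Real.pi_gt_three
  have hπ4 : π < 3.15 := Real.pi_lt_d2
  have hπ := Real.pi_pos
  have hb0 : 0 < b := by linarith
  set T₀ := dodgerT₀ b with hT₀
  set s := (0.1038 * Real.log (dodgerT₀ b) + 0.2573 * Real.log (Real.log (dodgerT₀ b)) + 9.3675 : ℝ) with hs
  have hTs : dodgerTstar b = T₀ - 4 * π * (s + 2) := rfl
  rw [hTs] at hA hB
  have hT'def : dodgerTprime b = π * (dodgerKprime b) / b := rfl
  set T' := dodgerTprime b with hT'
  rw [← hT'def] at hA hB hT3 hℓ2 hAT₀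
  set k : ℝ := (dodgerKprime b : ℝ) with hk
  have hπb : π / b ≤ 1 := by rw [div_le_one hb0]; linarith
  have h4πs : 4 * π * (s + 2) ≤ 12.6 * (3 * b + 2) := by
    have := mul_nonneg (by linarith only [hπ4] : (0:ℝ) ≤ 3.15 - π) (by linarith only [hs9] : (0:ℝ) ≤ s + 2)
    nlinarith only [this, hsb, hπ3, hs9]
  -- `T′ ≥ T₀ − 4π(s+2) − π/b ≥ 17e^{2b} − (37.8b + 26.2)`, and the linear term is absorbed by `e^{2b} ≥ 9000(b+1)`
  have hT'lo : 17 * Real.exp (2 * b) - (37.8 * b + 26.2) ≤ T' := by linarith only [hB, hπb, h4πs, hT₀ge]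
  have hT'17 : 16.99 * Real.exp (2 * b) ≤ T' := by nlinarith only [hT'lo, he9, hb]
  have hT'pos : 0 < T' := by nlinarith only [hT'17, he59]
  have hexp2b : Real.exp (2 * b) ≤ T' := by nlinarith only [hT'17, he59]
  have hT'big : 1000000 ≤ T' := by nlinarith only [hT'17, he59]
  have hT'b1 : 150000 * (b + 1) ≤ T' := by
    have := mul_le_mul_of_nonneg_left he9 (by norm_num : (0:ℝ) ≤ 16.99)
    linarith only [this, hT'17, hb]
  have hT'3600 : 3600 ≤ T' := by linarith only [hT'big]
  -- `T₀ ≤ 1.01 T′`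
  have h101 : T₀ ≤ 101 / 100 * T' := by nlinarith only [hB, hπb, h4πs, hT'b1, hb]
  -- `k′ = bT′/π ≤ 0.4 b T′`
  have hkT : k = b * T' / π := by rw [hT'def]; field_simp
  have hk04 : k ≤ 2 / 5 * b * T' := by
    rw [hkT, div_le_iff₀ hπ]
    have := mul_nonneg hb0.le hT'pos.le
    nlinarith only [this, hπ3]
  have hk0 : 0 ≤ k := by rw [hk]; exact Nat.cast_nonneg _
  -- `cI ≥ T′³/(19π)`
  have hlogT₀ : Real.log T₀ ≤ 2 * b + 3 := by
    have e1 : Real.log T₀ = Real.log (2 * π) + 1 + 2 * b := by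
      rw [hT₀, dodgerT₀, Real.log_mul (by positivity) (Real.exp_pos _).ne', Real.log_exp]; ring
    have hl2π2 : Real.log (2 * π) ≤ 2 := by
      have h72 := exp_numerics.2.1
      have : 2 * π ≤ Real.exp 2 := by linarith
      calc Real.log (2 * π) ≤ Real.log (Real.exp 2) := Real.log_le_log (by positivity) this
        _ = 2 := Real.log_exp 2
    linarith only [e1, hl2π2]
  have hlogT₀0 : 0 ≤ Real.log T₀ := by
    have : (1:ℝ) ≤ T₀ := by have := Real.exp_one_gt_d9; linarith only [this, hT₀e]
    exact Real.log_nonneg this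
  have ha : π * (3 * s + 5) / b + 1 ≤ T' / 100 := by
    have hps : π * (3 * s + 5) / b ≤ 32 := by
      rw [div_le_iff₀ hb0]
      have : π * (3 * s + 5) ≤ 3.15 * (9 * b + 5) := by
        have := mul_nonneg (by linarith only [hπ4] : (0:ℝ) ≤ 3.15 - π) (by linarith only [hs9] : (0:ℝ) ≤ 3 * s + 5)
        nlinarith only [this, hsb, hπ3, hs9]
      nlinarith only [this, hb]
    linarith only [hps, hT'big]
  have hcube : (99 / 100 * T') ^ 3 ≤ (T' - π * (3 * s + 5) / b - 1) ^ 3 :=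
    pow_le_pow_left₀ (by positivity) (by linarith only [ha]) 3
  have hsq : (s + 1) * (T' - 1) ^ 2 / 2 ≤ (3 * b + 1) * T' ^ 2 / 2 := by
    have h2 : (T' - 1) ^ 2 ≤ T' ^ 2 := by nlinarith only [hT'3600]
    have h3 : (s + 1) * (T' - 1) ^ 2 ≤ (3 * b + 1) * T' ^ 2 :=
      mul_le_mul (by linarith only [hsb]) h2 (sq_nonneg _) (by linarith only [hb])
    linarith only [h3]
  have hcI : T' ^ 3 / (19 * π) ≤ dodgerCI b := by
    rw [dodgerCI, ← hT', ← hs, ← hT₀]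
    have h4 : (Real.log T₀ + 1 / 3) / (6 * π) ≤ b := by
      rw [div_le_iff₀ (by positivity)]
      have : 18 * b ≤ b * (6 * π) := by nlinarith only [hπ3, hb0]
      linarith only [this, hlogT₀, hb]
    have h5 : (99 / 100 * T') ^ 3 / (18 * π) ≤ (T' - π * (3 * s + 5) / b - 1) ^ 3 / (18 * π) :=
      div_le_div_of_nonneg_right hcube (by positivity)
    have hd : (99 / 100 * T') ^ 3 / (18 * π) - T' ^ 3 / (19 * π) = 435681 / 342000000 * T' ^ 3 / π := by
      ring
    have h72 : 435681 / 342000000 * T' ^ 3 / 3.15 ≤ 435681 / 342000000 * T' ^ 3 / π :=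
      div_le_div_of_nonneg_left (by positivity) (by positivity) hπ4.le
    have hT2 : 0 ≤ T' ^ 2 := sq_nonneg _
    have hT3e : T' ^ 3 = T' * T' ^ 2 := by ring
    have p1 : 150000 * (b + 1) * T' ^ 2 ≤ T' ^ 3 := by
      rw [hT3e]; exact mul_le_mul_of_nonneg_right hT'b1 hT2
    have p2 : (1 : ℝ) ≤ T' ^ 2 := by nlinarith only [hT'3600]
    have p3 : b ≤ b * T' ^ 2 := by nlinarith only [p2, hb0]
    have key : T' ^ 3 / (19 * π) + b + (3 * b + 1) * T' ^ 2 / 2 ≤ (99 / 100 * T') ^ 3 / (18 * π) := by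
      have : b + (3 * b + 1) * T' ^ 2 / 2 ≤ 435681 / 342000000 * T' ^ 3 / 3.15 := by
        rw [le_div_iff₀ (by norm_num)]
        nlinarith only [p1, p3, hb0, hT2, hb]
      linarith only [this, hd, h72]
    linarith only [key, h4, h5, hsq]
  have hcI2 : dodgerCI b ≤ T' ^ 3 := by
    rw [dodgerCI, ← hT', ← hs, ← hT₀]
    have ha0 : 0 ≤ π * (3 * s + 5) / b + 1 := by
      have : 0 ≤ π * (3 * s + 5) / b := div_nonneg (by nlinarith only [hπ, hs9]) hb0.le
      linarith only [this]
    have hc3 : (T' - π * (3 * s + 5) / b - 1) ^ 3 ≤ T' ^ 3 :=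
      pow_le_pow_left₀ (by linarith only [ha, hT'pos]) (by linarith only [ha0]) 3
    have h1 : (T' - π * (3 * s + 5) / b - 1) ^ 3 / (18 * π) ≤ T' ^ 3 / (18 * π) :=
      div_le_div_of_nonneg_right hc3 (by positivity)
    have h2 : T' ^ 3 / (18 * π) ≤ T' ^ 3 := by
      rw [div_le_iff₀ (by positivity)]; nlinarith only [pow_pos hT'pos 3, hπ3]
    have hX : 0 ≤ (Real.log T₀ + 1 / 3) / (6 * π) := div_nonneg (by linarith only [hlogT₀0]) (by positivity)
    have hY : 0 ≤ (s + 1) * (T' - 1) ^ 2 / 2 :=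
      div_nonneg (mul_nonneg (by linarith only [hs9]) (sq_nonneg _)) (by norm_num)
    linarith only [h1, h2, hX, hY]
  have hcL : 1024 ≤ 4 * dodgerCI b := by
    have : T' ^ 3 / (19 * π) ≥ 256 := by
      rw [ge_iff_le, le_div_iff₀ (by positivity)]
      have h3 := pow_le_pow_left₀ (by norm_num : (0:ℝ) ≤ 3600) hT'3600 3
      nlinarith only [h3, hπ4]
    linarith only [this, hcI]
  have hpL : T' ^ 3 / (10 * π) ≤ dodgerPL b := by
    rw [dodgerPL, ← hk]
    have : k / 4 ≤ b * T' / 10 := by linarith only [hk04]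
    have h2 : T' ^ 3 / (10 * π) + b * T' / 10 ≤ 2 * (T' ^ 3 / (19 * π)) := by
      have h3 : 2 * (T' ^ 3 / (19 * π)) - T' ^ 3 / (10 * π) = T' ^ 3 / (190 * π) := by ring
      have h4 : b * T' / 10 ≤ T' ^ 3 / (190 * π) := by
        rw [div_le_div_iff₀ (by norm_num) (by positivity)]
        have hT3e : T' ^ 3 = T' * T' ^ 2 := by ring
        have p1 : 150000 * (b + 1) * T' ^ 2 ≤ T' ^ 3 := by rw [hT3e]; exact mul_le_mul_of_nonneg_right hT'b1 (sq_nonneg T')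
        have p2 : 3600 * T' ≤ T' ^ 2 := by nlinarith only [hT'3600]
        have p5 : b * T' * (190 * π) ≤ b * T' * 599 := by nlinarith only [hπ4, mul_nonneg hb0.le hT'pos.le]
        nlinarith only [p1, p2, p5, hb0, hT'pos]
      linarith only [h3, h4]
    linarith only [this, h2, hcI]
  have hW : dodgerW b ≤ 101 / 100 * T' ^ 2 := by
    rw [dodgerW, ← hT']; nlinarith only [hT'3600]
  have hW1 : T' ^ 2 ≤ dodgerW b := by rw [dodgerW, ← hT']; linarith only []
  have hk2' : (2 : ℝ) ≤ k := by rw [hk]; exact_mod_cast hk2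
  have hpU : dodgerPU b ≤ 41 / 100 * b * T' ^ 3 := by
    rw [dodgerPU, ← hk]
    calc k * dodgerW b ≤ 2 / 5 * b * T' * (101 / 100 * T' ^ 2) :=
          mul_le_mul hk04 hW (by rw [dodgerW]; positivity) (by positivity)
      _ ≤ 41 / 100 * b * T' ^ 3 := by nlinarith only [mul_nonneg hb0.le (pow_pos hT'pos 3).le]
  have hpU0 : 0 < dodgerPU b := by
    rw [dodgerPU, ← hk]; exact mul_pos (by linarith only [hk2']) (by rw [dodgerW]; positivity)
  have hT'17' : 17 * Real.exp (2 * b) ≤ T' := by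
    -- the sharper constant from `T₀ ≥ 17.07e^{2b}`
    have hegt := Real.exp_one_gt_d9
    have hπ3' : 3.1415 < π := Real.pi_gt_d4
    have hTe : T₀ = 2 * π * Real.exp 1 * Real.exp (2 * b) := by rw [hT₀, dodgerT₀, Real.exp_add]; ring
    have hc1 : (17.07 : ℝ) ≤ 2 * π * Real.exp 1 := by nlinarith only [hπ3', hegt]
    have hlo : 17.07 * Real.exp (2 * b) ≤ T₀ := by rw [hTe]; exact mul_le_mul_of_nonneg_right hc1 (Real.exp_pos _).le
    have hT'lo' : 17.07 * Real.exp (2 * b) - (37.8 * b + 26.2) ≤ T' := by linarith only [hB, hπb, h4πs, hlo]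
    nlinarith only [hT'lo', he9, hb]
  exact ⟨h101, hAT₀, hexp2b, hT'3600, hcI, hcI2, hcL, hpL, hpU0, hpU, hW1, hW, hk2', hk04, hT'17'⟩

end Summit.RiemannHypothesis.RiemannHypothesis.Theorems.Handoff

end
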